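import Mathlib
import Summits.Ventures.HodgeRepro2.Hypothesis
import Summits.Ventures.HodgeRepro2.BallActionU21

/-!
# Invariance of 1-forms under `U(2,1)` is a group condition

The `IsInvariantUnder α q` clause of `NonVanishingInput` (`Hypothesis.lean`) is the pull-back
identity `(α^* q)_j(z) = ∑ᵢ q(α·z)ᵢ ∂(α·z)ᵢ/∂zⱼ = q(z)_j` on the ball. This file checks that the
clause composes like a pull-back: it is closed under products and inverses in `U(2,1)`, and
holds for `1`. Consequently the `∀ γ ∈ Γ` clause only has to be checked on generators of `Γ`
(`isInvariantUnder_of_mem_closure`, `isInvariantUnder_realEmbedding_of_mem_closure`).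

* `isOpen_ball₂`; `differentiableAt_homog_apply`, `differentiableAt_mulVec_homog_apply`,
  `IsInU21.differentiableAt_ballAction`: the action is differentiable on the open ball.
* `IsInU21.fderiv_ballAction_mul`: the chain rule `D(αβ)_z = (Dα)_{β·z} ∘ (Dβ)_z` on the ball.
* `clm_apply_eq_sum`: a linear map on `ℂ²` is determined by its values on `e₀, e₁`.
* `isInvariantUnder_one`, **`IsInvariantUnder.mul`**, **`IsInvariantUnder.inv`**.
* `isInvariantUnder_of_mem_closure`: invariance on a generating set `S ⊆ U(2,1)` of a subgroup
  of `GL₃(ℂ)` gives invariance on the subgroup; `IsFrame.realEmbedding_inv` and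
  **`isInvariantUnder_realEmbedding_of_mem_closure`**: the same for `Γ = closure S ≤ unitaryGroup K H`
  transported through a frame — the form of the clause in `NonVanishingInput`.

Everything is proved; no new axioms.
-/

namespace Summit.Ventures.HodgeRepro2.ShimuraData

open Matrix

section Differentiability

/-! ### Differentiability of the action on the open ball -/

/-- The ball is open. -/
theorem isOpen_ball₂ : IsOpen ball₂ :=
  isOpen_lt (by fun_prop) continuous_const

/-- Each coordinate of `homog` is differentiable (it is affine). -/
theorem differentiableAt_homog_apply (z : Fin 2 → ℂ) (j : Fin 3) :
    DifferentiableAt ℂ (fun z => homog z j) z := by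
  refine Fin.lastCases ?_ (fun k => ?_) j
  · simp only [homog_last]
    exact differentiableAt_const _
  · simp only [homog_castSucc]
    exact differentiableAt_apply k z

/-- Each coordinate of `z ↦ α *ᵥ homog z` is differentiable. -/
theorem differentiableAt_mulVec_homog_apply (α : Matrix (Fin 3) (Fin 3) ℂ) (z : Fin 2 → ℂ)
    (i : Fin 3) : DifferentiableAt ℂ (fun z => (α *ᵥ homog z) i) z := by
  have h : (fun z => (α *ᵥ homog z) i) = ∑ j, fun z => α i j * homog z j := by
    funext z
    simp [Matrix.mulVec, dotProduct, Finset.sum_apply]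
  rw [h]
  exact DifferentiableAt.sum fun j _ => (differentiableAt_homog_apply z j).const_mul _

/-- `ballAction α` is differentiable on the ball for `α ∈ U(2,1)`. -/
theorem IsInU21.differentiableAt_ballAction {α : Matrix (Fin 3) (Fin 3) ℂ} (hα : IsInU21 α)
    {z : Fin 2 → ℂ} (hz : z ∈ ball₂) : DifferentiableAt ℂ (ballAction α) z := by
  refine differentiableAt_pi.2 fun k => ?_
  have hnum := differentiableAt_mulVec_homog_apply α z k.castSucc
  have hden := (differentiableAt_mulVec_homog_apply α z (Fin.last 2)).inv
    (hα.mulVec_homog_last_ne_zero hz)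
  have h := hnum.mul hden
  have e : (fun y => ballAction α y k) =
      fun y => (α *ᵥ homog y) k.castSucc * (fun y => (α *ᵥ homog y) (Fin.last 2))⁻¹ y := by
    funext y
    simp [ballAction, div_eq_mul_inv]
  rw [e]
  exact h

/-- The chain rule for the action: `D(αβ)_z = (Dα)_{β·z} ∘ (Dβ)_z` on the ball. -/
theorem IsInU21.fderiv_ballAction_mul {α β : Matrix (Fin 3) (Fin 3) ℂ} (hα : IsInU21 α)
    (hβ : IsInU21 β) {z : Fin 2 → ℂ} (hz : z ∈ ball₂) :
    fderiv ℂ (ballAction (α * β)) z =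
      (fderiv ℂ (ballAction α) (ballAction β z)).comp (fderiv ℂ (ballAction β) z) := by
  have heq : ballAction (α * β) =ᶠ[nhds z] (ballAction α ∘ ballAction β) := by
    filter_upwards [isOpen_ball₂.mem_nhds hz] with w hw
    exact hβ.ballAction_mul hw
  rw [heq.fderiv_eq]
  exact fderiv_comp z (hα.differentiableAt_ballAction (hβ.ballAction_mem_ball₂ hz))
    (hβ.differentiableAt_ballAction hz)

/-- `D(1)_z = id`. -/
theorem fderiv_ballAction_one (z : Fin 2 → ℂ) :
    fderiv ℂ (ballAction (1 : Matrix (Fin 3) (Fin 3) ℂ)) z = ContinuousLinearMap.id ℂ _ := by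
  have h1 : ballAction (1 : Matrix (Fin 3) (Fin 3) ℂ) = id := funext ballAction_one
  rw [h1, fderiv_id]

/-- On the ball, `(Dα)_{α⁻¹·z} ∘ (Dα⁻¹)_z = id`. -/
theorem IsInU21.fderiv_ballAction_comp_fderiv_ballAction_inv {α : Matrix (Fin 3) (Fin 3) ℂ}
    (hα : IsInU21 α) {z : Fin 2 → ℂ} (hz : z ∈ ball₂) :
    (fderiv ℂ (ballAction α) (ballAction α⁻¹ z)).comp (fderiv ℂ (ballAction α⁻¹) z) =
      ContinuousLinearMap.id ℂ _ := by
  rw [← hα.fderiv_ballAction_mul hα.inv hz, mul_nonsing_inv _ hα.isUnit_det, fderiv_ballAction_one]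

end Differentiability

section Invariance

/-! ### Invariance is closed under products and inverses -/

/-- A linear map on `ℂ²` is determined by its values on the basis vectors. -/
theorem clm_apply_eq_sum (L : (Fin 2 → ℂ) →L[ℂ] (Fin 2 → ℂ)) (v : Fin 2 → ℂ) (i : Fin 2) :
    L v i = ∑ l, v l * L (Pi.single l 1) i := by
  conv_lhs => rw [← Finset.univ_sum_single v, map_sum]
  rw [Finset.sum_apply]
  refine Finset.sum_congr rfl fun l _ => ?_
  have : (Pi.single l (v l) : Fin 2 → ℂ) = v l • (Pi.single l (1 : ℂ) : Fin 2 → ℂ) := by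
    rw [← Pi.single_smul', smul_eq_mul, mul_one]
  rw [this, map_smul, Pi.smul_apply, smul_eq_mul]

/-- Every 1-form is invariant under `1`. -/
theorem isInvariantUnder_one (q : (Fin 2 → ℂ) → Fin 2 → ℂ) : IsInvariantUnder 1 q := by
  intro z _ j
  rw [fderiv_ballAction_one, ContinuousLinearMap.id_apply]
  have h1 : ballAction (1 : Matrix (Fin 3) (Fin 3) ℂ) z = z := ballAction_one z
  simp [h1, Pi.single_apply]

/-- **Invariance is closed under products**: `α^*q = q` and `β^*q = q` give `(αβ)^*q = q`
(the chain rule). -/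
theorem IsInvariantUnder.mul {α β : Matrix (Fin 3) (Fin 3) ℂ} (hα : IsInU21 α) (hβ : IsInU21 β)
    {q : (Fin 2 → ℂ) → Fin 2 → ℂ} (hqα : IsInvariantUnder α q) (hqβ : IsInvariantUnder β q) :
    IsInvariantUnder (α * β) q := by
  intro z hz j
  have hw : ballAction β z ∈ ball₂ := hβ.ballAction_mem_ball₂ hz
  rw [hα.fderiv_ballAction_mul hβ hz, hβ.ballAction_mul hz]
  simp only [ContinuousLinearMap.comp_apply]
  set w := ballAction β z with hw_def
  set v := fderiv ℂ (ballAction β) z (Pi.single j 1) with hv_def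
  have key : fderiv ℂ (ballAction α) w v =
      fun i => ∑ l, v l * fderiv ℂ (ballAction α) w (Pi.single l 1) i :=
    funext (clm_apply_eq_sum _ v)
  rw [key]
  calc ∑ i, q (ballAction α w) i * ∑ l, v l * fderiv ℂ (ballAction α) w (Pi.single l 1) i
      = ∑ l, v l * ∑ i, q (ballAction α w) i * fderiv ℂ (ballAction α) w (Pi.single l 1) i := by
        simp only [Finset.mul_sum]
        rw [Finset.sum_comm]
        refine Finset.sum_congr rfl fun l _ => Finset.sum_congr rfl fun i _ => by ring
    _ = ∑ l, v l * q w l := by simp only [hqα w hw]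
    _ = ∑ l, q w l * v l := by simp only [mul_comm]
    _ = q z j := hqβ z hz j

/-- **Invariance is closed under inverses** in `U(2,1)`. -/
theorem IsInvariantUnder.inv {α : Matrix (Fin 3) (Fin 3) ℂ} (hα : IsInU21 α)
    {q : (Fin 2 → ℂ) → Fin 2 → ℂ} (hq : IsInvariantUnder α q) : IsInvariantUnder α⁻¹ q := by
  intro z hz j
  set w := ballAction α⁻¹ z with hw_def
  have hw : w ∈ ball₂ := hα.inv.ballAction_mem_ball₂ hz
  have hαw : ballAction α w = z := by
    rw [hw_def, ← hα.inv.ballAction_mul hz, mul_nonsing_inv _ hα.isUnit_det, ballAction_one]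
  have hq' : ∀ l, q w l = ∑ i, q z i * fderiv ℂ (ballAction α) w (Pi.single l 1) i := by
    intro l
    rw [← hq w hw l, hαw]
  set v := fderiv ℂ (ballAction α⁻¹) z (Pi.single j 1) with hv_def
  have hcomp : fderiv ℂ (ballAction α) w v = Pi.single j 1 := by
    have := congrArg (fun L : (Fin 2 → ℂ) →L[ℂ] (Fin 2 → ℂ) => L (Pi.single j 1))
      (hα.fderiv_ballAction_comp_fderiv_ballAction_inv hz)
    simpa [ContinuousLinearMap.comp_apply] using this
  calc ∑ l, q w l * v l
      = ∑ l, (∑ i, q z i * fderiv ℂ (ballAction α) w (Pi.single l 1) i) * v l := by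
        simp only [hq']
    _ = ∑ i, q z i * ∑ l, v l * fderiv ℂ (ballAction α) w (Pi.single l 1) i := by
        simp only [Finset.sum_mul, Finset.mul_sum]
        rw [Finset.sum_comm]
        refine Finset.sum_congr rfl fun i _ => Finset.sum_congr rfl fun l _ => by ring
    _ = ∑ i, q z i * fderiv ℂ (ballAction α) w v i := by
        refine Finset.sum_congr rfl fun i _ => ?_
        rw [clm_apply_eq_sum (fderiv ℂ (ballAction α) w) v i]
    _ = q z j := by
        rw [hcomp]
        simp [Pi.single_apply]

/-- Invariance on a generating set `S ⊆ U(2,1)` gives invariance on the generated subgroup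
of `GL₃(ℂ)`. -/
theorem isInvariantUnder_of_mem_closure {S : Set (GL (Fin 3) ℂ)} (hS : S ⊆ u21Subgroup)
    {q : (Fin 2 → ℂ) → Fin 2 → ℂ}
    (hq : ∀ s ∈ S, IsInvariantUnder (s : Matrix (Fin 3) (Fin 3) ℂ) q) {g : GL (Fin 3) ℂ}
    (hg : g ∈ Subgroup.closure S) : IsInvariantUnder (g : Matrix (Fin 3) (Fin 3) ℂ) q := by
  have key : IsInU21 (g : Matrix (Fin 3) (Fin 3) ℂ) ∧
      IsInvariantUnder (g : Matrix (Fin 3) (Fin 3) ℂ) q := by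
    refine Subgroup.closure_induction (p := fun (g : GL (Fin 3) ℂ) _ => IsInU21 (g : Matrix (Fin 3) (Fin 3) ℂ) ∧
      IsInvariantUnder (g : Matrix (Fin 3) (Fin 3) ℂ) q) ?_ ?_ ?_ ?_ hg
    · intro s hs
      exact ⟨hS hs, hq s hs⟩
    · exact ⟨isInU21_one, isInvariantUnder_one q⟩
    · intro a b _ _ ha hb
      exact ⟨ha.1.mul hb.1, ha.2.mul ha.1 hb.1 hb.2⟩
    · intro a _ ha
      rw [Matrix.coe_units_inv]
      exact ⟨ha.1.inv, ha.2.inv ha.1⟩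
  exact key.2

end Invariance

section Frame

/-! ### Through a frame: the clause of `NonVanishingInput` on generators -/

variable {K : Type*} [Field K] [NumberField K] [NumberField.IsCMField K]

omit [NumberField K] [NumberField.IsCMField K] in
/-- `realEmbedding` of an inverse is the inverse matrix, for an invertible frame. -/
theorem IsFrame.realEmbedding_inv {τ₁ : K →+* ℂ} {H : Matrix (Fin 3) (Fin 3) K}
    {Q : Matrix (Fin 3) (Fin 3) ℂ} (hQ : IsFrame K τ₁ H Q) (γ : GL (Fin 3) K) :
    realEmbedding K τ₁ Q γ⁻¹ = (realEmbedding K τ₁ Q γ)⁻¹ := by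
  symm
  apply Matrix.inv_eq_left_inv
  rw [← hQ.realEmbedding_mul, inv_mul_cancel, hQ.realEmbedding_one]

/-- **Generators suffice for the invariance clause of `NonVanishingInput`**: if `Γ` is generated
by `S ⊆ unitaryGroup K H` and the 1-form `q` is invariant under `realEmbedding K τ₁ Q s` for
every `s ∈ S`, then it is invariant under `realEmbedding K τ₁ Q γ` for every `γ ∈ Γ`. -/
theorem isInvariantUnder_realEmbedding_of_mem_closure {τ₁ : K →+* ℂ}
    {H : Matrix (Fin 3) (Fin 3) K} {Q : Matrix (Fin 3) (Fin 3) ℂ} (hQ : IsFrame K τ₁ H Q)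
    {S : Set (GL (Fin 3) K)} (hS : S ⊆ unitaryGroup K H) {q : (Fin 2 → ℂ) → Fin 2 → ℂ}
    (hq : ∀ s ∈ S, IsInvariantUnder (realEmbedding K τ₁ Q s) q) {γ : GL (Fin 3) K}
    (hγ : γ ∈ Subgroup.closure S) : IsInvariantUnder (realEmbedding K τ₁ Q γ) q := by
  have key : γ ∈ unitaryGroup K H ∧ IsInvariantUnder (realEmbedding K τ₁ Q γ) q := by
    refine Subgroup.closure_induction (p := fun (γ : GL (Fin 3) K) _ => γ ∈ unitaryGroup K H ∧
      IsInvariantUnder (realEmbedding K τ₁ Q γ) q) ?_ ?_ ?_ ?_ hγ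
    · intro s hs
      exact ⟨hS hs, hq s hs⟩
    · refine ⟨(unitaryGroup K H).one_mem, ?_⟩
      rw [hQ.realEmbedding_one]
      exact isInvariantUnder_one q
    · intro a b _ _ ha hb
      refine ⟨(unitaryGroup K H).mul_mem ha.1 hb.1, ?_⟩
      rw [hQ.realEmbedding_mul]
      exact ha.2.mul (hQ.isInU21_realEmbedding ha.1) (hQ.isInU21_realEmbedding hb.1) hb.2
    · intro a _ ha
      refine ⟨(unitaryGroup K H).inv_mem ha.1, ?_⟩
      rw [hQ.realEmbedding_inv]
      exact ha.2.inv (hQ.isInU21_realEmbedding ha.1)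
  exact key.2

end Frame

end Summit.Ventures.HodgeRepro2.ShimuraData
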